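import Summits.CriticalPhenomena.PercolationContinuityZ3.Theorems.PercNearOneGluingNoHeavyLowerTailSahiBlockExchangeable
import Summits.CriticalPhenomena.PercolationContinuityZ3.Theorems.PercNearOneGluingNoHeavyLowerTailSahiGridThreeCorollaries
import Summits.CriticalPhenomena.PercolationContinuityZ3.Theorems.PercNearOneGluingNoHeavyLowerTailSahiGridPatternKernel

/-!
# `NoHeavyLowerTail` (stmt-CriticalPhenomena-4575) — Kahn's `C₃` for THREE-BLOCK EXCHANGEABLE families on the Boolean
# cube, every product (coin) measure

Support file (bounded-`n` kernel-theorem seat prim-bnk-2, gen 13; `--supports stmt-CriticalPhenomena-4575`).  No named facts, no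
sorries, no new conjectures; nothing here is specific to percolation.

Context.  `…SahiBlockExchangeable` (prim-ineq-gen-4 gen 8) proved Sahi positivity of EVERY order for families of functions of the
cube `Fin (m + r) → Bool` that depend on a configuration only through its two BLOCK COUNTS, for every coin measure, by pushing the
coin weight forward to a product weight on the product of two chains and invoking the discrete Lieb–Sahi theorem for the square
(`ProductChains.sahiPositive_prodWeight_linearOrder`); its docstring records the three-block analogue as "exactly the first open
case" (`SahiThreeDim.liebSahi_prod₃_iff_fkg_prod₃`: product weights on products of THREE chains).  At ORDER THREE that case has
since been settled in the tree: the `[3]³` pattern inequality `PatternPos 3` is KERNEL-CHECKED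
(`SahiGridPattern.sStarD_three_nonneg`, `…SahiGridPatternKernel`, standard axioms) and implies that every FKG — in particular every
product — probability weight on every product `(Fin (a+1) × Fin (b+1)) × Fin (c+1)` of three finite chains is Sahi-positive of order
`3` (`prodWeight₃_three_kernel` below: the statement of `SahiGrid3.prodWeight₃_three`, re-derived with standard axioms through the box
embedding `SahiGrid3.boxEmb` and `SahiGridPattern.sahiPositive_three_of_latticeEmbedding_of_patternPos` instead of the computational
`…SahiGridThree`).  This file transports that theorem to the cube exactly as the two-block file did:

* `blockCount₃ m r s` — the three block counts of a configuration on `Fin (m + r + s)` (first `m`, middle `r`, last `s` coordinates);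
  `pushWeight_coinWeight_blockCount₃` — the push-forward of ANY coin weight along it is the product of the three block-count laws
  (the three counts of independent coins are independent);
* `sahiPositive_three_pushWeight_blockCount₃` — hence Sahi-positive of order `3`;
* **`sahiE_three_coinWeight_blockExchangeable₃_nonneg`** — for every `q : Fin (m+r+s) → [0,1]` and all nonnegative
  `g₀, g₁, g₂ : (Fin (m+1) × Fin (r+1)) × Fin (s+1) → ℝ` monotone in the three counts,
  `E₃^{coin q}(g₀ ∘ blockCount₃, g₁ ∘ blockCount₃, g₂ ∘ blockCount₃) ≥ 0`;
* **`sahiE3_prodBernoulli_blockExchangeable₃_nonneg`** — the EVENT form, literally an instance of the body of `KahnConjecture`: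
  for `p : Fin (m+r+s) → [0,1]` and up-sets `𝒰_A, 𝒰_B, 𝒰_C` of the count lattice `(Fin (m+1) × Fin (r+1)) × Fin (s+1)`,
  `0 ≤ sahiE3 (prodBernoulli p) {S | setBlockCount₃ S ∈ 𝒰_A} {S | setBlockCount₃ S ∈ 𝒰_B} {S | setBlockCount₃ S ∈ 𝒰_C}`.
  So Kahn's Conjecture 5 holds on `{0,1}^{m+r+s}`, for EVERY coin vector (not only block-constant ones), for every triple of
  increasing events each of which depends on `ω` only through `(|ω ∩ B₁|, |ω ∩ B₂|, |ω ∩ B₃|)` for a common partition of the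
  coordinates into three blocks — all weighted thresholds `a S₁ + b S₂ + c S₃ ≥ θ` (`a, b, c ≥ 0`), majorities of sub-blocks
  together with global thresholds, unions and intersections of such.
The four-block analogue at order `3` is the cube-side form of `PatternPos 4` (certified outside Lean by prim-sahi-p1, 2026-08-21; not
a tree theorem); higher orders for three blocks are Lieb–Sahi's conjecture on `[0,1]³` (open). [this work]
-/

namespace Summit.CriticalPhenomena.PercolationContinuityZ3.Theorems

namespace SahiBlockExchangeable

open Finset Function Literature.Combinatorics.Sahi2008
open scoped BigOperators

noncomputable section

variable {m r s : ℕ}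

/-- The **three block counts** of a configuration on `Fin (m + r + s)`: (number of `true`s among the first `m` coordinates,
number among the middle `r`, number among the last `s`), as an element of the product of three chains
`(Fin (m+1) × Fin (r+1)) × Fin (s+1)`. [this work] -/
def blockCount₃ (m r s : ℕ) (y : Fin (m + r + s) → Bool) : (Fin (m + 1) × Fin (r + 1)) × Fin (s + 1) :=
  (blockCount m r fun i : Fin (m + r) => y (Fin.castAdd s i), count fun k : Fin s => y (Fin.natAdd (m + r) k))

/-- On an appended configuration the three block counts are the two block counts of the first piece and the count of the
last piece. [this work] -/
theorem blockCount₃_append (y₁₂ : Fin (m + r) → Bool) (y₃ : Fin s → Bool) :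
    blockCount₃ m r s (Fin.append y₁₂ y₃) = (blockCount m r y₁₂, count y₃) := by
  unfold blockCount₃
  simp only [Fin.append_left, Fin.append_right]

/-- **The three block counts of independent coins are independent**: the push-forward of the coin weight `q` along
`blockCount₃` is the product of the push-forwards of the three block coin weights along their counts. [this work] -/
theorem pushWeight_coinWeight_blockCount₃ (q : Fin (m + r + s) → ℝ) :
    pushWeight (coinWeight q) (blockCount₃ m r s) = fun p =>
      pushWeight (coinWeight fun i : Fin m => q (Fin.castAdd s (Fin.castAdd r i))) count p.1.1 *
        pushWeight (coinWeight fun j : Fin r => q (Fin.castAdd s (Fin.natAdd m j))) count p.1.2 *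
          pushWeight (coinWeight fun k : Fin s => q (Fin.natAdd (m + r) k)) count p.2 := by
  classical
  funext p
  -- the first two factors are the push-forward of the first-(m+r)-block coins along the two-block count
  have h12 : pushWeight (coinWeight fun i : Fin (m + r) => q (Fin.castAdd s i)) (blockCount m r) p.1 =
      pushWeight (coinWeight fun i : Fin m => q (Fin.castAdd s (Fin.castAdd r i))) count p.1.1 *
        pushWeight (coinWeight fun j : Fin r => q (Fin.castAdd s (Fin.natAdd m j))) count p.1.2 := by
    rw [pushWeight_coinWeight_blockCount]
  rw [← h12, pushWeight_apply, pushWeight_apply, pushWeight_apply]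
  -- reindex the cube `Fin (m + r + s) → Bool` by pairs (first `m + r` coordinates, last `s` coordinates)
  rw [← Fintype.sum_equiv (Fin.appendEquiv (m + r) s)
    (fun yy => if blockCount₃ m r s (Fin.append yy.1 yy.2) = p then coinWeight q (Fin.append yy.1 yy.2) else 0) _
    (fun yy => rfl)]
  have hq : q = Fin.append (fun i : Fin (m + r) => q (Fin.castAdd s i)) (fun k : Fin s => q (Fin.natAdd (m + r) k)) :=
    (Fin.append_castAdd_natAdd (f := q)).symm
  simp only [blockCount₃_append]
  rw [Fintype.sum_prod_type, sum_mul_sum]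
  refine sum_congr rfl fun y₁₂ _ => sum_congr rfl fun y₃ _ => ?_
  rw [hq, coinWeight_append, ← hq]
  by_cases h1 : blockCount m r y₁₂ = p.1 <;> by_cases h2 : count y₃ = p.2 <;> simp [h1, h2, Prod.ext_iff]

/-- **Every product probability weight on a product of three finite chains is Sahi-positive of order `3`, with STANDARD AXIOMS**
(the statement of `SahiGrid3.prodWeight₃_three`, whose tree proof rests on the computational `…SahiGridThree`; here: the box is a
sublattice of the cube grid `Fin 3 → Fin (a+b+c+1)` via `SahiGrid3.boxEmb`, a product weight on it is FKG
(`SahiThreeDim.isFKGMeasure_prod₃`), and `PatternPos 3` is the kernel theorem `SahiGridPattern.sStarD_three_nonneg`). [this work] -/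
theorem prodWeight₃_three_kernel (a b c : ℕ) (w₁ : Fin (a + 1) → ℝ) (w₂ : Fin (b + 1) → ℝ) (w₃ : Fin (c + 1) → ℝ)
    (h₁0 : ∀ i, 0 ≤ w₁ i) (h₁1 : ∑ i, w₁ i = 1) (h₂0 : ∀ j, 0 ≤ w₂ j) (h₂1 : ∑ j, w₂ j = 1) (h₃0 : ∀ k, 0 ≤ w₃ k)
    (h₃1 : ∑ k, w₃ k = 1) :
    SahiPositive (fun p : (Fin (a + 1) × Fin (b + 1)) × Fin (c + 1) => w₁ p.1.1 * w₂ p.1.2 * w₃ p.2) 3 := by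
  classical
  exact SahiGridPattern.sahiPositive_three_of_latticeEmbedding_of_patternPos
    (fun A B C => SahiGridPattern.sStarD_three_nonneg A B C) (SahiGrid3.boxEmb a b c) (SahiGrid3.boxEmb_injective a b c)
    (SahiGrid3.boxEmb_inf a b c) (SahiGrid3.boxEmb_sup a b c) (SahiThreeDim.isFKGMeasure_prod₃ w₁ w₂ w₃ h₁0 h₁1 h₂0 h₂1 h₃0 h₃1)

/-- **The law of the three block counts is Sahi-positive of order `3`** (a product weight on a product of three finite chains,
`prodWeight₃_three_kernel` — the order-`3` case of the three-chain product hypothesis, settled through the `[3]³` pattern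
inequality, standard axioms). [this work] -/
theorem sahiPositive_three_pushWeight_blockCount₃ {q : Fin (m + r + s) → ℝ} (hq : ∀ i, 0 ≤ q i ∧ q i ≤ 1) :
    SahiPositive (pushWeight (coinWeight q) (blockCount₃ m r s)) 3 := by
  rw [pushWeight_coinWeight_blockCount₃]
  set w₁ : Fin (m + 1) → ℝ := pushWeight (coinWeight fun i : Fin m => q (Fin.castAdd s (Fin.castAdd r i))) count with hw₁
  set w₂ : Fin (r + 1) → ℝ := pushWeight (coinWeight fun j : Fin r => q (Fin.castAdd s (Fin.natAdd m j))) count with hw₂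
  set w₃ : Fin (s + 1) → ℝ := pushWeight (coinWeight fun k : Fin s => q (Fin.natAdd (m + r) k)) count with hw₃
  have h10 : ∀ x, 0 ≤ w₁ x := fun x => pushWeight_coinWeight_nonneg (fun i => hq _) _ x
  have h11 : ∑ x, w₁ x = 1 := sum_pushWeight_coinWeight _ _
  have h20 : ∀ y, 0 ≤ w₂ y := fun y => pushWeight_coinWeight_nonneg (fun j => hq _) _ y
  have h21 : ∑ y, w₂ y = 1 := sum_pushWeight_coinWeight _ _
  have h30 : ∀ z, 0 ≤ w₃ z := fun z => pushWeight_coinWeight_nonneg (fun k => hq _) _ z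
  have h31 : ∑ z, w₃ z = 1 := sum_pushWeight_coinWeight _ _
  exact prodWeight₃_three_kernel m r s w₁ w₂ w₃ h10 h11 h20 h21 h30 h31

/-- **Sahi's `C₃` for three-block exchangeable families under every coin measure.**  For `q ∈ [0,1]^{m+r+s}` and all
nonnegative `g_i : (Fin (m+1) × Fin (r+1)) × Fin (s+1) → ℝ` (`i < 3`) monotone in the triple of block counts,
`E₃^{coin q}(g₀ ∘ blockCount₃, g₁ ∘ blockCount₃, g₂ ∘ blockCount₃) ≥ 0` (Kahn's Conjecture 5 / Richards' `E₃ ≥ 0` for this class).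
[this work] -/
theorem sahiE_three_coinWeight_blockExchangeable₃_nonneg' {q : Fin (m + r + s) → ℝ} (hq : ∀ i, 0 ≤ q i ∧ q i ≤ 1)
    (g : Fin 3 → (Fin (m + 1) × Fin (r + 1)) × Fin (s + 1) → ℝ) (hg0 : ∀ i c, 0 ≤ g i c) (hmono : ∀ i, Monotone (g i)) :
    0 ≤ sahiE (coinWeight q) 3 fun i => g i ∘ blockCount₃ m r s := by
  rw [← sahiE_pushWeight]
  exact sahiPositive_three_pushWeight_blockCount₃ hq g hg0 hmono

/-- The same with the three functions listed (Kahn's `C₃` for three three-block exchangeable nonnegative monotone functions of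
independent coins). [this work] -/
theorem sahiE_three_coinWeight_blockExchangeable₃_nonneg {q : Fin (m + r + s) → ℝ} (hq : ∀ i, 0 ≤ q i ∧ q i ≤ 1)
    (g₀ g₁ g₂ : (Fin (m + 1) × Fin (r + 1)) × Fin (s + 1) → ℝ) (h0 : ∀ c, 0 ≤ g₀ c) (h1 : ∀ c, 0 ≤ g₁ c) (h2 : ∀ c, 0 ≤ g₂ c)
    (hm0 : Monotone g₀) (hm1 : Monotone g₁) (hm2 : Monotone g₂) :
    0 ≤ sahiE (coinWeight q) 3 ![g₀ ∘ blockCount₃ m r s, g₁ ∘ blockCount₃ m r s, g₂ ∘ blockCount₃ m r s] := by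
  have hfun : (![g₀ ∘ blockCount₃ m r s, g₁ ∘ blockCount₃ m r s, g₂ ∘ blockCount₃ m r s] :
      Fin 3 → (Fin (m + r + s) → Bool) → ℝ) = fun i => ![g₀, g₁, g₂] i ∘ blockCount₃ m r s := by
    funext i
    fin_cases i <;> rfl
  rw [hfun]
  exact sahiE_three_coinWeight_blockExchangeable₃_nonneg' hq ![g₀, g₁, g₂]
    (fun i c => by fin_cases i <;> simp [h0, h1, h2]) (fun i => by fin_cases i <;> simpa)

/-! ## Event form: Kahn's `C₃` statement for three-block exchangeable increasing events -/

section Events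

open Literature.Probability.LatticeModels (prodBernoulli sahiE3)
open Literature.Probability.Percolation.DecisionTree (ind ind_of_mem ind_of_not_mem ind_nonneg)

/-- The three block counts of a subset of `Fin (m + r + s)`. [this work] -/
def setBlockCount₃ (m r s : ℕ) (S : Set (Fin (m + r + s))) : (Fin (m + 1) × Fin (r + 1)) × Fin (s + 1) :=
  blockCount₃ m r s ((cubeEquivSet (m + r + s)).symm S)

/-- `setBlockCount₃` read through the equivalence (plumbing). [this work] -/
theorem setBlockCount₃_cubeEquivSet (y : Fin (m + r + s) → Bool) :
    setBlockCount₃ m r s (cubeEquivSet (m + r + s) y) = blockCount₃ m r s y := by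
  unfold setBlockCount₃
  rw [Equiv.symm_apply_apply]

/-- The indicator of `{S | setBlockCount₃ S ∈ 𝒰}`, read on Boolean configurations, is `ind 𝒰 ∘ blockCount₃` (plumbing).
[this work] -/
theorem ind_setOf_setBlockCount₃_comp (𝒰 : Set ((Fin (m + 1) × Fin (r + 1)) × Fin (s + 1))) :
    ind {S : Set (Fin (m + r + s)) | setBlockCount₃ m r s S ∈ 𝒰} ∘ cubeEquivSet (m + r + s) = ind 𝒰 ∘ blockCount₃ m r s := by
  funext y
  simp only [Function.comp_apply]
  by_cases h : blockCount₃ m r s y ∈ 𝒰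
  · rw [ind_of_mem h, ind_of_mem (show cubeEquivSet (m + r + s) y ∈ _ by
      rw [Set.mem_setOf_eq, setBlockCount₃_cubeEquivSet]; exact h)]
  · rw [ind_of_not_mem h, ind_of_not_mem (show cubeEquivSet (m + r + s) y ∉ _ by
      rw [Set.mem_setOf_eq, setBlockCount₃_cubeEquivSet]; exact h)]

/-- **Kahn's `C₃` for three-block exchangeable increasing events** (event form of
`sahiE_three_coinWeight_blockExchangeable₃_nonneg`): for every `p : Fin (m+r+s) → [0,1]` and all up-sets `𝒰_A, 𝒰_B, 𝒰_C` of
the count lattice `(Fin (m+1) × Fin (r+1)) × Fin (s+1)`, the three increasing events "the triple of block counts lies in `𝒰_·`"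
satisfy `0 ≤ E₃` under `prodBernoulli p` — an instance of the body of `KahnConjecture`, for every coin vector `p`. [this work] -/
theorem sahiE3_prodBernoulli_blockExchangeable₃_nonneg (p : Fin (m + r + s) → unitInterval)
    {UA UB UC : Set ((Fin (m + 1) × Fin (r + 1)) × Fin (s + 1))} (hA : IsUpperSet UA) (hB : IsUpperSet UB)
    (hC : IsUpperSet UC) :
    0 ≤ sahiE3 (prodBernoulli p) {S | setBlockCount₃ m r s S ∈ UA} {S | setBlockCount₃ m r s S ∈ UB}
      {S | setBlockCount₃ m r s S ∈ UC} := by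
  rw [← sahiE_three_ind, ← sahiE_comp_equiv (cubeEquivSet (m + r + s)) (bernoulliWeight p) 3,
    bernoulliWeight_comp_cubeEquivSet]
  have hfun : (fun i => (![ind {S : Set (Fin (m + r + s)) | setBlockCount₃ m r s S ∈ UA},
      ind {S : Set (Fin (m + r + s)) | setBlockCount₃ m r s S ∈ UB},
      ind {S : Set (Fin (m + r + s)) | setBlockCount₃ m r s S ∈ UC}] : Fin 3 → Set (Fin (m + r + s)) → ℝ) i ∘
        cubeEquivSet (m + r + s)) =
      ![ind UA ∘ blockCount₃ m r s, ind UB ∘ blockCount₃ m r s, ind UC ∘ blockCount₃ m r s] := by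
    funext i
    fin_cases i
    · exact ind_setOf_setBlockCount₃_comp UA
    · exact ind_setOf_setBlockCount₃_comp UB
    · exact ind_setOf_setBlockCount₃_comp UC
  rw [hfun]
  exact sahiE_three_coinWeight_blockExchangeable₃_nonneg (fun i => ⟨(p i).2.1, (p i).2.2⟩) (ind UA) (ind UB)
    (ind UC) (ind_nonneg UA) (ind_nonneg UB) (ind_nonneg UC) (monotone_ind_of_isUpperSet' hA)
    (monotone_ind_of_isUpperSet' hB) (monotone_ind_of_isUpperSet' hC)

end Events

end

end SahiBlockExchangeable

end Summit.CriticalPhenomena.PercolationContinuityZ3.Theorems
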